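import Summits.CriticalPhenomena.SAWScalingLimit.Theses.SAWConePseudogroup
import Summits.CriticalPhenomena.SAWScalingLimit.Theses.SAWConfRestriction
import Summits.CriticalPhenomena.SAWScalingLimit.Theorems.SAWLoopFugacityFlowSimpleSubseqLimitsPastFuturePinned
import Literature.Probability.RandomPlanarGeometry.SAWScalingLimitFamily
import HarnessLib.Audit

/-!
# Crux `SimpleOfLimit` (stmt-CriticalPhenomena-0774) — birth skeleton `Lines/birth.lean`

Route `SAWConePseudogroup` (rank 6; shared VERBATIM with route `SAWConfRestriction`, rank 5 — the two
decls agree by `Iff.rfl`, pin below). Crux, BY NAME: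
`Summit.CriticalPhenomena.SAWScalingLimit.Theses.SAWConePseudogroup.SimpleOfLimit` —
every chordal family `P` that is the FULL scaling limit of the critical `δℤ²` SAW laws
(`TendstoLaw (curve) (SAW.law D δ a_δ b_δ) id (P D)` along `𝓝[>] 0`, for every Dobrushin domain and
every endpoint approximation) is carried, in every `D`, by SIMPLE curve classes meeting `∂D` only at
the marked points: `∀ D, ∀ᵐ γ ∂(P D), γ ∈ CurveClass.simple ∧ γ.range ∩ frontier D.carrier ⊆ {D.pt 0, D.pt 1}`.

## The line: BOUNDARY AVOIDANCE, TWICE — the two lattice inputs of the sister crux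

`CurveClass.simple` is not closed (tree: `SimpleSubseqLimits.Negative.SimpleNotClosed`), so nothing soft
passes to the limit; the content is a pair of δ-UNIFORM LATTICE ESTIMATES on macroscopic events of the
critical SAW law, one per clause of the conclusion, followed by an open-set portmanteau passage and a
deterministic closing lemma — exactly the structure the sister crux `SimpleSubseqLimits`
(stmt-CriticalPhenomena-4982, SUBSEQUENTIAL limits; six lead seats) was reduced to, with its passages
LANDED in the tree (`Theorems/SAWLoopFugacityFlowSimpleSubseqLimits{FarReturnPassage,BoundaryPassage,
FarReturnLine,PastFuturePinned}.lean`). A full limit `P D` is in particular a subsequential limit along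
the reference meshes `1/(n+1)` of any endpoint approximation (`SAW.exists_isEndpointApprox`, Literature
theorem), so the SAME two inputs close this crux, and no third input exists. Hence the registered stubs
are the sister crux's two research-open lattice statements, BY NAME (same constants as the stubs
registered on stmt-4982, so one lattice proof closes both items):

* `stub_farReturnDecay : FarReturnDecay` — ORDER ("no macroscopic near-self-touching") typed as
  FIRST-ENTRANCE SLIT AVOIDANCE (`FarPast.Passage.FarReturnDecay`): for every ball `B̄(q,r)` and `θ > 0`
  there are `ε, r₀ < r < r'` such that, eventually as `δ → 0⁺`, with probability `≤ θ` the walk, after its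
  first entrance into `B(q,r')`, comes `ε`-close to a past value taken outside the guard ball `B̄(q,5r)`.
  OPEN (no technique in print gives δ-uniform exponent-type bounds at `x_c`; only sub-ballisticity /
  endpoint delocalisation are unconditional). Pinned in the tree: summit ⇒ it
  (`farReturnDecay_of_sawScalingLimit`), `EventualTight ∧ SimpleSubseqLimits ⇒` it (`farReturnDecay_of_crux`).
* `stub_boundaryDecay : BoundaryDecay` — BOUNDARY ("no boundary crawling", `Boundary.Passage.BoundaryDecay`):
  for every `ρ, θ > 0` there is `ε > 0` such that, eventually, with probability `≤ θ` the walk visits the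
  `ε`-neighbourhood of `∂D` at a point `ρ`-far from both marked points. OPEN (same wall; Kennedy–Lawler
  lattice effects near general Jordan boundaries). Pinned: `boundaryDecay_of_sawScalingLimit`, `boundaryDecay_of_crux`.
* `stub_pastFutureAvoidance : PastFutureAvoidance` — the lattice prover's TARGET form of ORDER
  (`FarPast.Line.PastFutureAvoidance`, polyline-level past/future return AT the first entrance into
  `B̄(q,r')`, the event the exact domain Markov property turns into "the critical SAW of the slit graph
  avoids the far part of the slit", LSW04 §3.4.5 averaged over the past). OPEN; implies stub 1
  (`farReturnDecay_of_pastFutureAvoidance`), summit-implied (`pastFutureAvoidance_of_sawScalingLimit`).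

`SimpleOfLimit_of (hF : Registered.stub_farReturnDecay) (hB : Registered.stub_boundaryDecay) : SimpleOfLimit`
is PROVED below (no sorry): reference approximation, reference meshes, `P D` as an `IsSubseqLimit`, then
the landed passages `FarPast.Passage.ae_simple_of_farReturnDecayAt` (open-set portmanteau on the thickened
far-return events over Gaussian-rational data + guarded Rohde–Schramm closing `FirstHitFlatGuard`) and
`Boundary.Passage.ae_boundary_of_boundaryDecayAt` (portmanteau + `1`-Lipschitz `infDist` closing).
`SimpleOfLimit_of'` is the same from the target form (stub 3 + stub 2); `SimpleOfLimit_proof` /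
`SimpleOfLimit_proof'` wire the sorried stubs into the crux under BOTH route decl names
(`SAWConePseudogroup.SimpleOfLimit`, `SAWConfRestriction.SimpleOfLimit` — the same statement).

Pins (all proved): `simpleOfLimit_iff_confRestriction` (the two route decls of the shared item agree,
`Iff.rfl`); `simpleOfLimit_of_simpleSubseqLimits` (stmt-4982 ⇒ stmt-0774 outright);
`simpleSubseqLimits_of_simpleOfLimit` (stmt-0774 ⇒ stmt-4982 GIVEN `LimitExists`, the declared dep of this
item on both routes: a subsequential limit of a fully convergent family IS `P D`); hence
`simpleOfLimit_iff_lattice : EventualTight → LimitExists → (SimpleOfLimit ↔ FarReturnDecay ∧ BoundaryDecay)`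
— the residual certificate: modulo the existence inputs every route wanting this item already carries,
the crux IS the conjunction of the two registered lattice stubs; and `stubs_of_sawScalingLimit` (no stub is
over-strong: all three are consequences of the summit conjecture).

Sorries: exactly 3 = the three `stub_*`; zero elsewhere. Disproof used: none (no `Disproof.lean` on
stmt-0774; the sister's `Cruxes/SimpleSubseqLimits/Disproof.lean` §4/§7/§9/§15 is honoured: no soft /
closedness argument, no range-only data, inputs pinned to `x_c` through `SAW.law`). Negatives honoured:
stmt-0772 (all-`δ` tightness) is not used. BC3 probes (planner folder `bc/probe_*.lean`): for each stub,
`stub → SimpleOfLimit` and `stub → SAWScalingLimit` by `first | exact? | simpa | aesop` (and the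
`simpa [stub] | (unfold stub; simpa)` variant) FAIL.
-/

noncomputable section

open MeasureTheory Filter Topology Set Metric Function
open Literature.Probability.RandomPlanarGeometry Literature.Probability.RandomPlanarGeometry.SAW
open Literature.Probability.LatticeModels
open scoped ENNReal NNReal BoundedContinuousFunction MeasureTheory Topology ProbabilityTheory

namespace Summit.CriticalPhenomena.SAWScalingLimit.Cruxes.SimpleOfLimit.Birth

open Summit.CriticalPhenomena.SAWScalingLimit.Theses.SAWConePseudogroup (SimpleOfLimit LimitExists)
open Summit.CriticalPhenomena.SAWScalingLimit.Theses.SAWLoopFugacityFlow (SimpleSubseqLimits EventualTight)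
open Summit.CriticalPhenomena.SAWScalingLimit.Theorems.SimpleSubseqLimits.MarkedPointRevisit.Passage
  (IsSubseqLimit)
open Summit.CriticalPhenomena.SAWScalingLimit.Theorems.SimpleSubseqLimits.Boundary.Passage
  (BoundaryDecayAt BoundaryDecay ae_boundary_of_boundaryDecayAt)
open Summit.CriticalPhenomena.SAWScalingLimit.Theorems.SimpleSubseqLimits.FarPast.Passage
  (FarReturnDecayAt FarReturnDecay ae_simple_of_farReturnDecayAt)
open Summit.CriticalPhenomena.SAWScalingLimit.Theorems.SimpleSubseqLimits.FarPast.Line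
  (PastFutureAvoidance line_farReturn farReturnDecay_of_pastFutureAvoidance crux_iff_farLattice
    farLattice_of_sawScalingLimit)
open Summit.CriticalPhenomena.SAWScalingLimit.Theorems.SimpleSubseqLimits.FarPast.Pinned
  (pastFutureAvoidance_of_sawScalingLimit)

/-! ## The registered stubs (research-open lattice inputs, BY NAME = the stubs registered on stmt-4982) -/

/-- **stub 1 — FAR-RETURN DECAY** (ORDER input, first-entrance slit avoidance; OPEN).
`FarPast.Passage.FarReturnDecay`: along every endpoint approximation of every Dobrushin domain,
`∀ q r θ, 0 < r → 0 < θ → ∃ ε r₀ r', 0 < ε ∧ 0 < r₀ ∧ r₀ < r ∧ r < r' ∧ ∀ᶠ δ in 𝓝[>] 0,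
law_δ {curve ∈ nearFarReturnEvent q r₀ r r' ε} ≤ θ`.
Sources: LawlerSchrammWerner2004SAW §3.4.5 (heuristic), KennedyLawler2013 (arXiv:1109.3091),
DuminilCopinHammond2013 (sub-ballisticity, the strongest unconditional control). -/
theorem stub_farReturnDecay : FarReturnDecay := by
  sorry

/-- **stub 2 — BOUNDARY DECAY** (BOUNDARY input, "no boundary crawling"; OPEN).
`Boundary.Passage.BoundaryDecay`: along every endpoint approximation of every Dobrushin domain,
`∀ ρ θ, 0 < ρ → 0 < θ → ∃ ε, 0 < ε ∧ ∀ᶠ δ in 𝓝[>] 0, law_δ {curve ∈ nearBoundaryVisitEvent D ρ ε} ≤ θ`.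
Sources: LawlerSchrammWerner2004SAW §3.4.5 / p.14, KennedyLawler2013 p.11 (boundary lattice effects). -/
theorem stub_boundaryDecay : BoundaryDecay := by
  sorry

/-- **stub 3 — PAST/FUTURE AVOIDANCE AT FIRST ENTRANCES** (the lattice prover's target form of ORDER;
OPEN; implies stub 1 by `FarPast.Line.farReturnDecay_of_pastFutureAvoidance`).
`FarPast.Line.PastFutureAvoidance`: `∀ q r θ, 0 < r → 0 < θ → ∃ ε r', 0 < ε ∧ r < r' ∧ r' ≤ 5r ∧
∀ᶠ δ in 𝓝[>] 0, law_δ {PastFutureReturn (latticeCurve ·) q r r' ε} ≤ θ` along every endpoint approximation.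
Sources: LawlerSchrammWerner2004SAW §3.4.5 ("the rest of the walk avoids its past as it avoids the
boundary"), LawlerSchrammWerner2003Restriction §3. -/
theorem stub_pastFutureAvoidance : PastFutureAvoidance := by
  sorry

/-! ## Name-keyed aliases of the stub statements (skeleton-check convention: the hypotheses of
`SimpleOfLimit_of` are exactly the declared stubs, each BY NAME) -/

namespace Registered

/-- Alias keyed by the stub name: the statement of `stub_farReturnDecay`. -/
abbrev stub_farReturnDecay : Prop := FarReturnDecay
/-- Alias keyed by the stub name: the statement of `stub_boundaryDecay`. -/
abbrev stub_boundaryDecay : Prop := BoundaryDecay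
/-- Alias keyed by the stub name: the statement of `stub_pastFutureAvoidance`. -/
abbrev stub_pastFutureAvoidance : Prop := PastFutureAvoidance

end Registered

/-! ## Proved glue: a full limit is a subsequential limit -/

/-- The reference mesh sequence `1/(n+1) → 0⁺`. [folklore] -/
theorem tendsto_refMesh : Tendsto (fun n : ℕ => 1 / ((n : ℝ) + 1)) atTop (𝓝[>] (0 : ℝ)) :=
  tendsto_nhdsWithin_iff.2 ⟨tendsto_one_div_add_atTop_nhds_zero_nat,
    Filter.Eventually.of_forall fun _ => Set.mem_Ioi.2 Nat.one_div_pos_of_nat⟩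

/-- **A full limit is a subsequential limit.** If `P` is chordal and `P D` is the full `𝓝[>] 0` limit
of the pushed-forward critical SAW laws of `(D; a_δ, b_δ)`, then along every mesh sequence `s n → 0⁺`
the probability measure `P D` is a subsequential weak limit in the sense `IsSubseqLimit D a b s (P D)` of
the sister crux's passages. [folklore] -/
theorem isSubseqLimit_of_tendstoLaw {P : ChordalFamily} (hPch : P.IsChordal) {D : DobrushinDomain}
    {a b : ℝ → Site 2}
    (hlim : TendstoLaw (fun δ (γ : SAW.DomainSAW D.carrier δ (a δ) (b δ)) => γ.curve)
      (fun δ => SAW.law D.carrier δ (a δ) (b δ)) id (P D))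
    {s : ℕ → ℝ} (hs : Tendsto s atTop (𝓝[>] (0 : ℝ))) : IsSubseqLimit D a b s (P D) := by
  refine ⟨hs, (hPch D).1, fun f => ?_⟩
  have h := (hlim f).comp hs
  simpa only [id_eq, Function.comp_def] using h

/-! ## The composition: the crux BY NAME from the two lattice stubs -/

/-- **`SimpleOfLimit` from far-return decay and boundary decay.** Fix a chordal full limit `P` and a
Dobrushin domain `D`; pick an endpoint approximation `(a, b)` of `D` (`SAW.exists_isEndpointApprox`) and
the reference meshes `1/(n+1)`; then `P D` is a probability subsequential limit of the critical SAW laws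
of `(D; a_δ, b_δ)` (`isSubseqLimit_of_tendstoLaw`). Far-return decay at `(D; a, b)` makes it carried by
SIMPLE classes (`FarPast.Passage.ae_simple_of_farReturnDecayAt`: the exact far-return events over
Gaussian-rational data are `P D`-null by the open-set portmanteau, and a class avoiding all of them is
simple by the guarded Rohde–Schramm lemma); boundary decay gives the boundary clause
(`Boundary.Passage.ae_boundary_of_boundaryDecayAt`). [cite: LawlerSchrammWerner2004SAW, §3.4.5] -/
theorem SimpleOfLimit_of (hF : Registered.stub_farReturnDecay) (hB : Registered.stub_boundaryDecay) :
    Summit.CriticalPhenomena.SAWScalingLimit.Theses.SAWConePseudogroup.SimpleOfLimit := by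
  intro P hPch hlim D
  -- a reference endpoint approximation of `D` and the reference meshes
  obtain ⟨a, b, hab⟩ := SAW.exists_isEndpointApprox D
  have hL : IsSubseqLimit D a b (fun n : ℕ => 1 / ((n : ℝ) + 1)) (P D) :=
    isSubseqLimit_of_tendstoLaw hPch (hlim D a b hab) tendsto_refMesh
  -- ORDER: simple classes, from far-return decay at `(D; a, b)`
  have hsimple : ∀ᵐ c ∂(P D), c ∈ CurveClass.simple :=
    ae_simple_of_farReturnDecayAt hab (hF D a b hab) hL
  -- BOUNDARY: the trace meets `∂D` only at the marked points, from boundary decay at `(D; a, b)`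
  have hbdry : ∀ᵐ c ∂(P D), c.range ∩ frontier D.carrier ⊆ {D.pt 0, D.pt 1} :=
    ae_boundary_of_boundaryDecayAt (hB D a b hab) hL
  filter_upwards [hsimple, hbdry] with c h1 h2
  exact ⟨h1, h2⟩

/-- The same composition from the lattice prover's target form of ORDER (stub 3) and stub 2:
past/future avoidance at first entrances implies far-return decay
(`FarPast.Line.farReturnDecay_of_pastFutureAvoidance`). [folklore] -/
theorem SimpleOfLimit_of' (hP : Registered.stub_pastFutureAvoidance) (hB : Registered.stub_boundaryDecay) :
    Summit.CriticalPhenomena.SAWScalingLimit.Theses.SAWConePseudogroup.SimpleOfLimit :=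
  SimpleOfLimit_of (farReturnDecay_of_pastFutureAvoidance hP) hB

/-- **Wiring (skeleton-check convention `<Crux>_proof`)**: the crux BY NAME — route
`SAWConePseudogroup`'s decl — from the registered, sorried stubs; their statements are exactly the
hypotheses of `SimpleOfLimit_of`. (Inherits the stubs' `sorry`; claims nothing.) -/
theorem SimpleOfLimit_proof :
    Summit.CriticalPhenomena.SAWScalingLimit.Theses.SAWConePseudogroup.SimpleOfLimit :=
  SimpleOfLimit_of stub_farReturnDecay stub_boundaryDecay

/-- **Wiring for the sibling decl** (route `SAWConfRestriction`, the item's first route; the two decls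
are the same statement, `simpleOfLimit_iff_confRestriction` below): the crux BY THAT NAME from the same
registered stubs. (Inherits the stubs' `sorry`; claims nothing.) -/
theorem SimpleOfLimit_proof' :
    Summit.CriticalPhenomena.SAWScalingLimit.Theses.SAWConfRestriction.SimpleOfLimit :=
  SimpleOfLimit_of stub_farReturnDecay stub_boundaryDecay

/-- The composition concluding the sibling decl by name (same proof term). [folklore] -/
theorem SimpleOfLimit_of_confRestriction (hF : Registered.stub_farReturnDecay)
    (hB : Registered.stub_boundaryDecay) :
    Summit.CriticalPhenomena.SAWScalingLimit.Theses.SAWConfRestriction.SimpleOfLimit :=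
  SimpleOfLimit_of hF hB

/-! ## Pins (documentation, all proved) -/

/-- The two route decls of the shared item stmt-0774 agree (verbatim the same statement). [folklore] -/
theorem simpleOfLimit_iff_confRestriction :
    Summit.CriticalPhenomena.SAWScalingLimit.Theses.SAWConePseudogroup.SimpleOfLimit ↔
      Summit.CriticalPhenomena.SAWScalingLimit.Theses.SAWConfRestriction.SimpleOfLimit :=
  Iff.rfl

/-- **stmt-4982 ⇒ stmt-0774 outright**: simple boundary-avoiding SUBSEQUENTIAL limits give simple
boundary-avoiding FULL limits (a full limit is a subsequential limit of a reference approximation).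
[folklore] -/
theorem simpleOfLimit_of_simpleSubseqLimits (h : SimpleSubseqLimits) :
    Summit.CriticalPhenomena.SAWScalingLimit.Theses.SAWConePseudogroup.SimpleOfLimit := by
  intro P hPch hlim D
  obtain ⟨a, b, hab⟩ := SAW.exists_isEndpointApprox D
  have hL := isSubseqLimit_of_tendstoLaw hPch (hlim D a b hab) tendsto_refMesh
  exact (h D a b hab _ (P D) hL.1 hL.2.1 hL.2.2).mono fun c hc => ⟨hc.1, hc.2.2.2.2⟩

/-- **stmt-0774 ⇒ stmt-4982 given `LimitExists`** (the declared dep of this item on both routes): when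
the full limit `P` exists, every probability subsequential limit `ν` of `(D; a_δ, b_δ)` along any
endpoint approximation and any mesh sequence IS `P D` (bounded continuous integrals determine finite Borel
measures; limits are unique), so it inherits simplicity and boundary avoidance from `SimpleOfLimit` and
endpoints/confinement from chordality. [folklore] -/
theorem simpleSubseqLimits_of_simpleOfLimit (hLim : LimitExists)
    (h : Summit.CriticalPhenomena.SAWScalingLimit.Theses.SAWConePseudogroup.SimpleOfLimit) :
    SimpleSubseqLimits := by
  obtain ⟨P, hPch, hPlim⟩ := hLim
  intro D a b hab s ν hs hν hw
  haveI := (hPch D).1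
  haveI := hν
  -- the subsequential limit is the full limit
  have hνP : ν = P D := by
    refine ext_of_forall_integral_eq_of_IsFiniteMeasure fun f => ?_
    have h2 : Tendsto (fun n => ∫ γ, f γ.curve ∂(SAW.law D.carrier (s n) (a (s n)) (b (s n)))) atTop
        (𝓝 (∫ x, f x ∂(P D))) := ((isSubseqLimit_of_tendstoLaw hPch (hPlim D a b hab) hs).2.2) f
    exact tendsto_nhds_unique (hw f) h2
  rw [hνP]
  filter_upwards [h P hPch hPlim D, (hPch D).2] with c h1 h2
  exact ⟨h1.1, h2.1, h2.2.1, h2.2.2, h1.2⟩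

/-- Hence, given `LimitExists`, the two crux items stmt-0774 and stmt-4982 are ONE statement. [folklore] -/
theorem simpleOfLimit_iff_simpleSubseqLimits (hLim : LimitExists) :
    Summit.CriticalPhenomena.SAWScalingLimit.Theses.SAWConePseudogroup.SimpleOfLimit ↔ SimpleSubseqLimits :=
  ⟨simpleSubseqLimits_of_simpleOfLimit hLim, simpleOfLimit_of_simpleSubseqLimits⟩

/-- **RESIDUAL CERTIFICATE for stmt-0774.** Modulo the existence inputs `EventualTight` (stmt-1372) and
`LimitExists` (stmt-1371) that every route wanting this item already carries, the crux IS the conjunction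
of the two registered lattice stubs (via the sister's `FarPast.Line.crux_iff_farLattice`). [folklore] -/
theorem simpleOfLimit_iff_lattice (hT : EventualTight) (hLim : LimitExists) :
    Summit.CriticalPhenomena.SAWScalingLimit.Theses.SAWConePseudogroup.SimpleOfLimit ↔
      FarReturnDecay ∧ BoundaryDecay :=
  (simpleOfLimit_iff_simpleSubseqLimits hLim).trans (crux_iff_farLattice hT)

/-- **No stub is over-strong**: all three registered stubs are consequences of the summit conjecture
`SAWScalingLimit` (tree pins of the sister crux). [folklore] -/
theorem stubs_of_sawScalingLimit (h : _root_.SAWScalingLimit) :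
    Registered.stub_farReturnDecay ∧ Registered.stub_boundaryDecay ∧ Registered.stub_pastFutureAvoidance :=
  ⟨(farLattice_of_sawScalingLimit h).1, (farLattice_of_sawScalingLimit h).2,
    pastFutureAvoidance_of_sawScalingLimit h⟩

end Summit.CriticalPhenomena.SAWScalingLimit.Cruxes.SimpleOfLimit.Birth

end
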